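import Literature.NumberTheory.EllipticCurves.KuriharaNumberInvariants
import HarnessLib

/-!
# Level lowering kills Kurihara numbers mod `p`, part 1/3: additive characters, `1`-periodic functions with a Hecke relation, and the fibres of `ℤ/qm → ℤ/m` (cell `b2b-bsdres`, seat additive-p4, line V39)

HONEST FRAMING (verbatim, cell `b2b-bsdres`): the goal of the cell is to DELETE the COMBINATION-SHAPED
residual classes for ALL analytic-rank `≤ 1` curves over `ℚ` — "full BSD formula for every rank `≤ 1`
curve in class `C`" assembled STRICTLY from published theorems — so that the rank-`≤ 1` remainder
becomes exactly the CONSTRUCTION-SHAPED classes, which are TYPED (missing-input Props), NOT attempted;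
this is not "finishing BSD". This file: a research-route KERNEL LEMMA file (pure algebra; no named fact,
no conjecture, nothing booked; X4 stays CONSTRUCTION-SHAPED).

Content (the bookkeeping layer of the theorem proved in part 2,
`X4/KuriharaLevelLoweringDescent.lean`, and applied in part 3, `X4/KuriharaLevelLowering.lean`):
§1 additive characters `ψ_q` of `(ℤ/q)ˣ` read on `(ℤ/m)ˣ` and the weights `W_T = ∏_{q ∈ T} ψ_q` with
their binomial expansion `W_T(ub) = ∑_{T' ⊆ T} (∏_{T∖T'} ψ(u)) W_{T'}(b)`; §2 `1`-periodic functions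
`μ : ℚ → R`, the weight-`2` Hecke relation `∑_{j mod q} μ((r+j)/q) + μ(qr) = a μ(r)`
(Mazur–Tate–Teitelbaum 1986 §I.4 (4.2)) and the values `lev μ m x = μ(x/m)`; §3 the fibre of
`ℤ/qm → ℤ/m` over `b` is `{b + jm}`, its full sum of `μ(·/qm)` is `a μ(b/m) − μ(qb/m)` (Hecke), and
over a unit `b` the unit part of the fibre omits exactly `q·(q⁻¹b)~`, whose value is `μ(q⁻¹b/m)`.

## References

* B. Mazur, J. Tate, J. Teitelbaum, Invent. Math. 84 (1986), §I.4 (4.2). [cite: MazurTateTeitelbaum1986Invent, §I.4 (4.2)]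
* M. Kurihara, Contrib. Math. Comput. Sci. 7 (2014) 317–356, §1.1. [cite: Kurihara2014, §1.1]
-/

noncomputable section

open scoped MatrixGroups ModularForm

open CongruenceSubgroup Finset

open Literature.NumberTheory.EllipticCurves Literature.NumberTheory.EllipticCurves.ModularForms

namespace Summit.BirchSwinnertonDyer.Rank1Residual.LevelLowering

variable {R : Type*}

/-! ### §1 Additive characters of `(ℤ/q)ˣ` pulled back to `(ℤ/m)ˣ`, and the weights `∏_{q ∈ T} ψ_q` -/

section Characters

variable [CommRing R] (ψ : (ℓ : ℕ) → (ZMod ℓ)ˣ →* Multiplicative R)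

/-- The additive character `ψ_q` of `(ℤ/q)ˣ` read on `(ℤ/m)ˣ` through `(ℤ/m)ˣ → (ℤ/q)ˣ` when `q ∣ m`
(and `0` otherwise — never used). [folklore] -/
def chi (m q : ℕ) (a : (ZMod m)ˣ) : R :=
  if h : q ∣ m then Multiplicative.toAdd (ψ q (ZMod.unitsMap h a)) else 0

/-- Unfolding `chi` at a divisor. [folklore] -/
theorem chi_of_dvd {m q : ℕ} (h : q ∣ m) (a : (ZMod m)ˣ) :
    chi ψ m q a = Multiplicative.toAdd (ψ q (ZMod.unitsMap h a)) :=
  dif_pos h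

/-- `chi` is additive. [folklore] -/
theorem chi_mul {m q : ℕ} (h : q ∣ m) (a b : (ZMod m)ˣ) :
    chi ψ m q (a * b) = chi ψ m q a + chi ψ m q b := by
  simp only [chi_of_dvd ψ h, map_mul, toAdd_mul]

/-- `chi` of an inverse. [folklore] -/
theorem chi_inv {m q : ℕ} (h : q ∣ m) (a : (ZMod m)ˣ) : chi ψ m q a⁻¹ = -chi ψ m q a := by
  simp only [chi_of_dvd ψ h, map_inv, toAdd_inv]

/-- Compatibility of `chi` with the reduction `(ℤ/n)ˣ → (ℤ/m)ˣ`. [folklore] -/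
theorem chi_unitsMap {n m q : ℕ} (hm : m ∣ n) (hq : q ∣ m) (a : (ZMod n)ˣ) :
    chi ψ m q (ZMod.unitsMap hm a) = chi ψ n q a := by
  rw [chi_of_dvd ψ hq, chi_of_dvd ψ (dvd_trans hq hm), ← MonoidHom.comp_apply (ZMod.unitsMap hq)
    (ZMod.unitsMap hm) a, ZMod.unitsMap_comp]

/-- The weight `W_T(a) = ∏_{q ∈ T} ψ_q(a)` on `(ℤ/m)ˣ`. [folklore] -/
def weight (m : ℕ) (T : Finset ℕ) (a : (ZMod m)ˣ) : R :=
  ∏ q ∈ T, chi ψ m q a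

/-- Compatibility of the weight with reduction of the level. [folklore] -/
theorem weight_unitsMap {n m : ℕ} (hm : m ∣ n) {T : Finset ℕ} (hT : ∀ q ∈ T, q ∣ m)
    (a : (ZMod n)ˣ) : weight ψ m T (ZMod.unitsMap hm a) = weight ψ n T a :=
  Finset.prod_congr rfl fun q hq ↦ chi_unitsMap ψ hm (hT q hq) a

/-- **The binomial expansion of the weight**:
`W_T(u·b) = ∑_{T' ⊆ T} (∏_{q ∈ T ∖ T'} ψ_q(u)) · W_{T'}(b)`. [folklore] -/
theorem weight_mul {m : ℕ} {T : Finset ℕ} (hT : ∀ q ∈ T, q ∣ m) (u b : (ZMod m)ˣ) :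
    weight ψ m T (u * b) = ∑ T' ∈ T.powerset, (∏ q ∈ T \ T', chi ψ m q u) * weight ψ m T' b := by
  unfold weight
  have h : ∀ q ∈ T, chi ψ m q (u * b) = chi ψ m q b + chi ψ m q u := fun q hq ↦ by
    rw [chi_mul ψ (hT q hq), add_comm]
  rw [Finset.prod_congr rfl h, Finset.prod_add]
  exact Finset.sum_congr rfl fun T' _ ↦ mul_comm _ _

end Characters

/-! ### §2 `1`-periodic functions on `ℚ` and their values at the residues `a/m` -/

section Periodic

/-- `μ` is `1`-periodic: `μ(r + z) = μ(r)` for `z ∈ ℤ` (the function `r ↦ {∞ → r}` of a modular symbol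
for `Γ₀(N) ∋ (1 1; 0 1)`; MTT §I.4). [cite: MazurTateTeitelbaum1986Invent, §I.4 (4.2)] -/
def IsPeriodic (μ : ℚ → R) : Prop :=
  ∀ (r : ℚ) (z : ℤ), μ (r + z) = μ r

/-- The weight-`2` **Hecke relation** at the prime `q` with eigenvalue `a`:
`∑_{j mod q} μ((r+j)/q) + μ(q r) = a · μ(r)` (MTT §I.4 (4.2): `a_q [r] = ∑_u [(r+u)/q] + [q r]`).
[cite: MazurTateTeitelbaum1986Invent, §I.4 (4.2)] -/
def HeckeRel [CommRing R] (μ : ℚ → R) (q : ℕ) (a : R) : Prop :=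
  ∀ r : ℚ, ∑ j ∈ Finset.range q, μ ((r + j) / q) + μ (q * r) = a * μ r

/-- The value `μ(x/m)` at a residue `x ∈ ℤ/m` (representative `x.val ∈ [0, m)`). [folklore] -/
def lev (μ : ℚ → R) (m : ℕ) (x : ZMod m) : R :=
  μ ((x.val : ℚ) / m)

variable {μ : ℚ → R}

/-- A periodic `μ` takes the same value at rationals differing by an integer. [folklore] -/
theorem IsPeriodic.eq_of_eq_add_int (hμ : IsPeriodic μ) {r s : ℚ} (z : ℤ) (h : r = s + z) :
    μ r = μ s := by
  rw [h, hμ]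

/-- `lev μ m k = μ(k/m)` for every natural representative `k`. [folklore] -/
theorem lev_natCast (hμ : IsPeriodic μ) (m k : ℕ) [NeZero m] :
    lev μ m (k : ZMod m) = μ ((k : ℚ) / m) := by
  unfold lev
  rw [ZMod.val_natCast]
  have hm : (m : ℚ) ≠ 0 := by exact_mod_cast NeZero.ne m
  have hk : ((k % m : ℕ) : ℚ) = (k : ℚ) - (m : ℚ) * ((k / m : ℕ) : ℚ) := by
    have := Nat.mod_add_div k m
    have h' : ((k % m : ℕ) : ℚ) + (m : ℚ) * ((k / m : ℕ) : ℚ) = (k : ℚ) := by exact_mod_cast this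
    linarith
  refine hμ.eq_of_eq_add_int (-((k / m : ℕ) : ℤ)) ?_
  rw [Int.cast_neg, Int.cast_natCast, hk]
  field_simp
  ring

/-- `lev μ m (k · x) = μ(k · x.val / m)`. [folklore] -/
theorem lev_natCast_mul (hμ : IsPeriodic μ) (m k : ℕ) [NeZero m] (x : ZMod m) :
    lev μ m ((k : ZMod m) * x) = μ ((k : ℚ) * x.val / m) := by
  have : (k : ZMod m) * x = ((k * x.val : ℕ) : ZMod m) := by
    rw [Nat.cast_mul, ZMod.natCast_zmod_val]
  rw [this, lev_natCast hμ]
  push_cast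
  ring_nf

/-- **Multiplication by `q` drops the level**: `lev μ (q m) (q · y) = lev μ m (y mod m)`
(`(q·y)/(qm) = y/m`). [folklore] -/
theorem lev_mul_left_eq_lev_castHom (hμ : IsPeriodic μ) (m q : ℕ) [NeZero m] [NeZero (q * m)]
    (hq : 0 < q) (y : ZMod (q * m)) :
    lev μ (q * m) ((q : ZMod (q * m)) * y) =
      lev μ m (ZMod.castHom (dvd_mul_left m q) (ZMod m) y) := by
  rw [lev_natCast_mul hμ, ZMod.castHom_apply, ZMod.cast_eq_val, lev_natCast hμ]
  congr 1
  have hm : (m : ℚ) ≠ 0 := by exact_mod_cast NeZero.ne m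
  have hq' : (q : ℚ) ≠ 0 := by exact_mod_cast hq.ne'
  push_cast
  field_simp

/-- `q · y` only depends on `y mod m` in `ℤ/qm`. [folklore] -/
theorem mul_eq_mul_of_castHom_eq (m q : ℕ) [NeZero m] [NeZero (q * m)] {y y' : ZMod (q * m)}
    (h : ZMod.castHom (dvd_mul_left m q) (ZMod m) y =
      ZMod.castHom (dvd_mul_left m q) (ZMod m) y') :
    (q : ZMod (q * m)) * y = (q : ZMod (q * m)) * y' := by
  rw [← sub_eq_zero, ← mul_sub]
  have h0 : ZMod.castHom (dvd_mul_left m q) (ZMod m) (y - y') = 0 := by rw [map_sub, h, sub_self]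
  rw [← ZMod.natCast_zmod_val (y - y'), map_natCast, ZMod.natCast_eq_zero_iff] at h0
  obtain ⟨c, hc⟩ := h0
  rw [← ZMod.natCast_zmod_val (y - y'), hc, ← Nat.cast_mul, ZMod.natCast_eq_zero_iff]
  exact ⟨c, by ring⟩

end Periodic


/-! ### §3 Fibres of `ℤ/qm → ℤ/m`: all lifts, and the unit lifts of a unit -/

section Fibres

variable {μ : ℚ → R}

/-- The fibre of `ℤ/qm → ℤ/m` over `b` is `{b + j·m : j < q}`. [folklore] -/
theorem filter_castHom_eq_image (m q : ℕ) [NeZero m] [NeZero (q * m)] (b : ZMod m) :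
    (Finset.univ.filter fun y : ZMod (q * m) ↦ ZMod.castHom (dvd_mul_left m q) (ZMod m) y = b) =
      (Finset.range q).image fun j ↦ ((b.val + j * m : ℕ) : ZMod (q * m)) := by
  have hm : 0 < m := Nat.pos_of_ne_zero (NeZero.ne m)
  ext y
  simp only [Finset.mem_filter, Finset.mem_univ, true_and, Finset.mem_image, Finset.mem_range]
  constructor
  · intro hy
    refine ⟨y.val / m, (Nat.div_lt_iff_lt_mul hm).mpr (ZMod.val_lt y), ?_⟩
    have hb : b.val = y.val % m := by
      have := congrArg ZMod.val hy
      rw [ZMod.castHom_apply, ZMod.cast_eq_val, ZMod.val_natCast] at this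
      exact this.symm
    rw [hb, Nat.mod_add_div' y.val m, ZMod.natCast_zmod_val]
  · rintro ⟨j, -, rfl⟩
    rw [map_natCast, Nat.cast_add, Nat.cast_mul, ZMod.natCast_self, mul_zero, add_zero,
      ZMod.natCast_zmod_val]

/-- The parametrisation `j ↦ b + j·m` of the fibre is injective on `j < q`. [folklore] -/
theorem fibre_injOn (m q : ℕ) [NeZero m] (b : ZMod m) :
    Set.InjOn (fun j ↦ ((b.val + j * m : ℕ) : ZMod (q * m))) (Finset.range q) := by
  intro j hj j' hj' h
  have hm : 0 < m := Nat.pos_of_ne_zero (NeZero.ne m)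
  have hlt : ∀ i ∈ (Finset.range q : Set ℕ), b.val + i * m < q * m := fun i hi ↦ by
    have hi' : i + 1 ≤ q := Finset.mem_range.mp hi
    have hb := ZMod.val_lt b
    calc b.val + i * m < m + i * m := by omega
      _ = (i + 1) * m := by ring
      _ ≤ q * m := Nat.mul_le_mul_right m hi'
  have := congrArg ZMod.val h
  simp only [ZMod.val_natCast, Nat.mod_eq_of_lt (hlt j hj), Nat.mod_eq_of_lt (hlt j' hj')] at this
  exact Nat.eq_of_mul_eq_mul_right hm (by omega)

/-- **The full fibre sum**: `∑_{y ≡ b (m)} μ(y/qm) = a·μ(b/m) − μ(qb/m)` from the Hecke relation at `q`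
(the lifts of `b` are `b + jm`, and `(b + jm)/(qm) = (b/m + j)/q`). [cite: MazurTateTeitelbaum1986Invent, §I.4 (4.2)] -/
theorem sum_fibre_lev [CommRing R] (hμ : IsPeriodic μ) (m q : ℕ) [NeZero m] [NeZero (q * m)]
    {a : R} (hH : HeckeRel μ q a) (b : ZMod m) :
    ∑ y ∈ Finset.univ.filter (fun y : ZMod (q * m) ↦ ZMod.castHom (dvd_mul_left m q) (ZMod m) y = b),
      lev μ (q * m) y = a * lev μ m b - lev μ m ((q : ZMod m) * b) := by
  have hm : (m : ℚ) ≠ 0 := by exact_mod_cast NeZero.ne m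
  have hq : (q : ℚ) ≠ 0 := by
    have : q * m ≠ 0 := NeZero.ne (q * m)
    exact_mod_cast left_ne_zero_of_mul this
  rw [filter_castHom_eq_image m q b, Finset.sum_image (fibre_injOn m q b)]
  have hterm : ∀ j ∈ Finset.range q,
      lev μ (q * m) ((b.val + j * m : ℕ) : ZMod (q * m)) = μ ((((b.val : ℚ) / m) + j) / q) := by
    intro j _
    rw [lev_natCast hμ]
    congr 1
    push_cast
    field_simp
  rw [Finset.sum_congr rfl hterm, lev_natCast_mul hμ, mul_div_assoc]
  exact eq_sub_of_add_eq (hH _)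

/-- **The unit fibre sum**: for a unit `b` of `ℤ/m` (`q` prime, `q ∤ m`), the units of `ℤ/qm` above
`b` are all lifts but the one divisible by `q`, namely `q·(q⁻¹b)~`, so
`∑_{v unit, v ≡ b} μ(v/qm) = a·μ(b/m) − μ(qb/m) − μ(q⁻¹b/m)`. [folklore] -/
theorem sum_units_fibre_lev [CommRing R] (hμ : IsPeriodic μ) (m q : ℕ) [NeZero m] [NeZero (q * m)]
    (hq : q.Prime) (hmq : m.Coprime q) {a : R} (hH : HeckeRel μ q a) (b : (ZMod m)ˣ) :
    ∑ v ∈ Finset.univ.filter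
        (fun v : (ZMod (q * m))ˣ ↦ ZMod.unitsMap (dvd_mul_left m q) v = b),
      lev μ (q * m) (v : ZMod (q * m)) =
      a * lev μ m b - lev μ m ((q : ZMod m) * b) -
        lev μ m ((b * (ZMod.unitOfCoprime q hmq.symm)⁻¹ : (ZMod m)ˣ) : ZMod m) := by
  classical
  set π := ZMod.castHom (dvd_mul_left m q) (ZMod m) with hπ
  set uq : (ZMod m)ˣ := ZMod.unitOfCoprime q hmq.symm with huq
  have huqval : (uq : ZMod m) = q := ZMod.coe_unitOfCoprime q hmq.symm
  set y0 : ZMod (q * m) :=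
    (q : ZMod (q * m)) * ((((b * uq⁻¹ : (ZMod m)ˣ) : ZMod m).val : ℕ) : ZMod (q * m)) with hy0
  -- (1) the sum over the units is the sum over the unit elements of the fibre
  have h1 : ∑ v ∈ Finset.univ.filter (fun v : (ZMod (q * m))ˣ ↦ ZMod.unitsMap (dvd_mul_left m q) v = b),
      lev μ (q * m) (v : ZMod (q * m)) =
      ∑ y ∈ (Finset.univ.filter fun y : ZMod (q * m) ↦ π y = b).filter (fun y ↦ IsUnit y),
        lev μ (q * m) y := by
    refine Finset.sum_nbij (fun v : (ZMod (q * m))ˣ ↦ (v : ZMod (q * m))) ?_ ?_ ?_ (fun _ _ ↦ rfl)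
    · intro v hv
      have hv' := (Finset.mem_filter.mp hv).2
      refine Finset.mem_filter.mpr ⟨Finset.mem_filter.mpr ⟨Finset.mem_univ _, ?_⟩, Units.isUnit v⟩
      rw [hπ, ZMod.castHom_apply, ← ZMod.unitsMap_val (dvd_mul_left m q), hv']
    · exact fun _ _ _ _ h ↦ Units.ext h
    · intro y hy
      obtain ⟨hy1, hu⟩ := Finset.mem_filter.mp (Finset.mem_coe.mp hy)
      have hy2 := (Finset.mem_filter.mp hy1).2
      rw [hπ, ZMod.castHom_apply] at hy2
      refine ⟨hu.unit, Finset.mem_coe.mpr (Finset.mem_filter.mpr ⟨Finset.mem_univ _, Units.ext ?_⟩),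
        hu.unit_spec⟩
      rw [ZMod.unitsMap_val, hu.unit_spec, hy2]
  -- (2) the non-unit part of the fibre is the single element `y0`
  have h3 : (Finset.univ.filter fun y : ZMod (q * m) ↦ π y = b).filter (fun y ↦ ¬IsUnit y) = {y0} := by
    ext y
    simp only [Finset.mem_filter, Finset.mem_univ, true_and, Finset.mem_singleton]
    constructor
    · rintro ⟨hy, hnu⟩
      have hcopm : y.val.Coprime m := by
        have hu : IsUnit ((y.val : ℕ) : ZMod m) := by
          have : π y = ((y.val : ℕ) : ZMod m) := by rw [hπ, ZMod.castHom_apply, ZMod.cast_eq_val]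
          rw [← this, hy]
          exact Units.isUnit b
        exact (ZMod.isUnit_iff_coprime y.val m).mp hu
      have hncop : ¬y.val.Coprime (q * m) := by
        intro hc
        apply hnu
        rw [← ZMod.natCast_zmod_val y]
        exact (ZMod.isUnit_iff_coprime _ _).mpr hc
      have hqdvd : q ∣ y.val := by
        by_contra hnd
        exact hncop (Nat.Coprime.mul_right
          (Nat.coprime_comm.mp (hq.coprime_iff_not_dvd.mpr hnd)) hcopm)
      obtain ⟨t, ht⟩ := hqdvd
      have hy' : y = (q : ZMod (q * m)) * (t : ZMod (q * m)) := by
        rw [← ZMod.natCast_zmod_val y, ht, Nat.cast_mul]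
      rw [hy', hy0]
      apply mul_eq_mul_of_castHom_eq m q
      rw [map_natCast, map_natCast, ZMod.natCast_zmod_val]
      have hqt : (q : ZMod m) * (t : ZMod m) = (b : ZMod m) := by
        rw [← Nat.cast_mul, ← ht, ← map_natCast π, ZMod.natCast_zmod_val, hy]
      rw [Units.val_mul]
      calc (t : ZMod m) = ((uq⁻¹ : (ZMod m)ˣ) : ZMod m) * ((uq : ZMod m) * (t : ZMod m)) := by
            rw [← mul_assoc, Units.inv_mul, one_mul]
        _ = (b : ZMod m) * ((uq⁻¹ : (ZMod m)ˣ) : ZMod m) := by rw [huqval, hqt, mul_comm]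
    · rintro rfl
      refine ⟨?_, ?_⟩
      · rw [hy0, map_mul, map_natCast, map_natCast, ZMod.natCast_zmod_val, Units.val_mul,
          ← huqval, mul_left_comm, Units.mul_inv, mul_one]
      · intro hu
        have : IsUnit (q : ZMod (q * m)) := isUnit_of_mul_isUnit_left hu
        exact (ZMod.isUnit_prime_iff_not_dvd hq).mp this (dvd_mul_right q m)
  -- (3) the value at `y0`
  have h4 : lev μ (q * m) y0 = lev μ m ((b * uq⁻¹ : (ZMod m)ˣ) : ZMod m) := by
    rw [hy0, lev_mul_left_eq_lev_castHom hμ m q hq.pos, map_natCast, ZMod.natCast_zmod_val]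
  -- (4) assemble
  have h2 := Finset.sum_filter_add_sum_filter_not
    (Finset.univ.filter fun y : ZMod (q * m) ↦ π y = b) (fun y ↦ IsUnit y) (lev μ (q * m))
  rw [h3, Finset.sum_singleton, h4] at h2
  rw [h1, eq_sub_of_add_eq h2, hπ, sum_fibre_lev hμ m q hH]

end Fibres


end Summit.BirchSwinnertonDyer.Rank1Residual.LevelLowering

end
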